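import Literature.NumberTheory.Sieve.GreenTao2008MoebiusLogSum
import Literature.NumberTheory.Sieve.CoprimeSquarefreeSums
import Literature.NumberTheory.LFunctions.MertensElementary
import Mathlib.NumberTheory.EulerProduct.Basic
import HarnessLib

/-!
# `∑_{n ≤ y, (n,q)=1} μ(n) log(y/n)/n = q/φ(q) + o(1)` (coprimality-twisted Riesz means of `μ`)

Everything in this file is PROVED. Second brick of the elementary proof of
Green–Tao's Proposition 9.5 (`Literature.NumberTheory.Sieve.GreenTao2008.GoldstonYildirimLinearForms`): after Selberg's
diagonalisation of `∑ μ(d)μ(d') log(R/d) log(R/d')/[d,d']` (file `GreenTao2008SelbergDiagonal`)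
one needs the sums

  `M₁(y; q) = ∑_{n ≤ y, (n, q) = 1} μ(n) log(y/n) / n`     (`coprimeLogSum q y`),

which are reduced here to the `q = 1` sums `M₁(u)` of `GreenTao2008MoebiusLogSum` by removing the
coprimality condition: `μ · 1_{(·,q)=1} = 1_{q-smooth} ⋆ μ` (Dirichlet convolution), whence

  `M₁(y; q) = ∑_{k ≤ y, p ∣ k ⇒ p ∣ q} M₁(y/k) / k`     (`coprimeLogSum_eq_sum_smooth`).

With `M₁(u) → 1`, `sup |M₁| ≤ C₀` and the Euler products `∑_{p∣k ⇒ p∣q} k^{-σ} = ∏_{p ∣ q}(1 - p^{-σ})⁻¹`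
(Mathlib's `EulerProduct.summable_and_hasSum_factoredNumbers_prod_filter_prime_geometric`) this gives

* `abs_coprimeLogSum_le`: `|M₁(y; q)| ≤ C₀ ∏_{p ∣ q} (1 - 1/p)⁻¹ = C₀ q/φ(q)`;
* `abs_coprimeLogSum_sub_le`: `|M₁(y; q) - q/φ(q)| ≤ C e^{-c√(log y/2)} q/φ(q) + (C₀+2) y^{-1/4} ∏_{p∣q}(1 - p^{-1/2})⁻¹`
  for `y ≥ 4`.

## References

* B. Green, T. Tao, Ann. of Math. 167 (2008), §10 (the estimate these sums feed). [cite: GreenTaoAnnals2008]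
* S. W. Graham, *An asymptotic estimate related to Selberg's sieve*, J. Number Theory 10 (1978),
  83–94 (the same reduction for `∑ μ²…`-type Selberg sums). [folklore]
* H. L. Montgomery, R. C. Vaughan, *Multiplicative Number Theory I*, CUP 2007, §8.1. [cite: MontgomeryVaughan2007]
-/

noncomputable section

open Real Finset Filter ArithmeticFunction
open scoped ArithmeticFunction.Moebius ArithmeticFunction.zeta

namespace Literature.NumberTheory.Sieve.GreenTao2008

/-! ### Euler-type products over a finite set of primes -/

/-- `E_σ(P) = ∏_{p ∈ P} (1 - p^{-σ})⁻¹` (for `P` the prime factors of `q` and `σ = 1` this is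
`q/φ(q)`). [folklore] -/
def eulerFactorProd (σ : ℝ) (P : Finset ℕ) : ℝ := ∏ p ∈ P, (1 - (p : ℝ) ^ (-σ))⁻¹

/-- Unfolding `E_σ(P)`. [folklore] -/
theorem eulerFactorProd_def (σ : ℝ) (P : Finset ℕ) :
    eulerFactorProd σ P = ∏ p ∈ P, (1 - (p : ℝ) ^ (-σ))⁻¹ := rfl

/-- For a prime `p` and `σ > 0`: `0 < p^{-σ} < 1`. [folklore] -/
theorem prime_rpow_neg_lt_one {p : ℕ} (hp : p.Prime) {σ : ℝ} (hσ : 0 < σ) :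
    0 < (p : ℝ) ^ (-σ) ∧ (p : ℝ) ^ (-σ) < 1 := by
  have hp1 : (1 : ℝ) < p := by exact_mod_cast hp.one_lt
  refine ⟨Real.rpow_pos_of_pos (by linarith) _, ?_⟩
  exact Real.rpow_lt_one_of_one_lt_of_neg hp1 (by linarith)

/-- Each Euler factor satisfies `1 ≤ (1 - p^{-σ})⁻¹`. [folklore] -/
theorem one_le_eulerFactor {p : ℕ} (hp : p.Prime) {σ : ℝ} (hσ : 0 < σ) :
    1 ≤ (1 - (p : ℝ) ^ (-σ))⁻¹ := by
  obtain ⟨h0, h1⟩ := prime_rpow_neg_lt_one hp hσ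
  rw [le_inv_comm₀ one_pos (by linarith), inv_one]
  linarith

/-- `E_σ(P) ≥ 1` for a set of primes `P`. [folklore] -/
theorem one_le_eulerFactorProd {σ : ℝ} (hσ : 0 < σ) {P : Finset ℕ} (hP : ∀ p ∈ P, p.Prime) :
    1 ≤ eulerFactorProd σ P := by
  unfold eulerFactorProd
  calc (1 : ℝ) = ∏ _p ∈ P, (1 : ℝ) := by simp
    _ ≤ ∏ p ∈ P, (1 - (p : ℝ) ^ (-σ))⁻¹ :=
        prod_le_prod (fun _ _ => zero_le_one) fun p hp => one_le_eulerFactor (hP p hp) hσ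

/-- `E_σ(P) > 0`. [folklore] -/
theorem eulerFactorProd_pos {σ : ℝ} (hσ : 0 < σ) {P : Finset ℕ} (hP : ∀ p ∈ P, p.Prime) :
    0 < eulerFactorProd σ P :=
  lt_of_lt_of_le one_pos (one_le_eulerFactorProd hσ hP)

/-- `E_σ` is monotone in the set of primes. [folklore] -/
theorem eulerFactorProd_mono {σ : ℝ} (hσ : 0 < σ) {P Q : Finset ℕ} (hPQ : P ⊆ Q)
    (hQ : ∀ p ∈ Q, p.Prime) : eulerFactorProd σ P ≤ eulerFactorProd σ Q := by
  unfold eulerFactorProd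
  exact prod_le_prod_of_subset_of_one_le hPQ
    (fun p hp => zero_le_one.trans (one_le_eulerFactor (hQ p (hPQ hp)) hσ))
    fun p hp _ => one_le_eulerFactor (hQ p hp) hσ

/-- `E_σ(P ∪ Q) ≤ E_σ(P) E_σ(Q)` (equality for disjoint sets). [folklore] -/
theorem eulerFactorProd_union_le {σ : ℝ} (hσ : 0 < σ) {P Q : Finset ℕ} (hP : ∀ p ∈ P, p.Prime)
    (hQ : ∀ p ∈ Q, p.Prime) :
    eulerFactorProd σ (P ∪ Q) ≤ eulerFactorProd σ P * eulerFactorProd σ Q := by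
  classical
  unfold eulerFactorProd
  rw [← prod_union_inter]
  have h1 : 1 ≤ ∏ p ∈ P ∩ Q, (1 - (p : ℝ) ^ (-σ))⁻¹ := by
    calc (1 : ℝ) = ∏ _p ∈ P ∩ Q, (1 : ℝ) := by simp
      _ ≤ _ := prod_le_prod (fun _ _ => zero_le_one) fun p hp =>
          one_le_eulerFactor (hP p (mem_inter.1 hp).1) hσ
  have h0 : 0 ≤ ∏ p ∈ P ∪ Q, (1 - (p : ℝ) ^ (-σ))⁻¹ :=
    prod_nonneg fun p hp => (zero_le_one.trans (one_le_eulerFactor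
      (by rcases mem_union.1 hp with h | h; exacts [hP p h, hQ p h]) hσ))
  calc ∏ p ∈ P ∪ Q, (1 - (p : ℝ) ^ (-σ))⁻¹ = (∏ p ∈ P ∪ Q, (1 - (p : ℝ) ^ (-σ))⁻¹) * 1 := (mul_one _).symm
    _ ≤ (∏ p ∈ P ∪ Q, (1 - (p : ℝ) ^ (-σ))⁻¹) * ∏ p ∈ P ∩ Q, (1 - (p : ℝ) ^ (-σ))⁻¹ :=
        mul_le_mul_of_nonneg_left h1 h0

/-- **`E_1(primeFactors q) = q/φ(q)`** (Euler's product for `φ`). [folklore] -/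
theorem eulerFactorProd_one_primeFactors {q : ℕ} (hq : q ≠ 0) :
    eulerFactorProd 1 q.primeFactors = (q : ℝ) / (q.totient : ℝ) := by
  have hφ := Literature.NumberTheory.LFunctions.MertensBound.totient_eq_mul_prod_one_sub_inv q
  have hq0 : (0 : ℝ) < q := by exact_mod_cast Nat.pos_of_ne_zero hq
  have hprod : ∏ p ∈ q.primeFactors, (1 - 1 / (p : ℝ)) ≠ 0 := by
    refine prod_ne_zero_iff.2 fun p hp => ?_
    have hp2 : (2 : ℝ) ≤ p := by exact_mod_cast (Nat.prime_of_mem_primeFactors hp).two_le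
    have : 1 / (p : ℝ) ≤ 1 / 2 := by
      rw [div_le_div_iff₀ (by linarith) (by norm_num)]; linarith
    linarith
  unfold eulerFactorProd
  have h1 : ∏ p ∈ q.primeFactors, (1 - (p : ℝ) ^ (-(1 : ℝ)))⁻¹ =
      (∏ p ∈ q.primeFactors, (1 - 1 / (p : ℝ)))⁻¹ := by
    rw [← prod_inv_distrib]
    refine prod_congr rfl fun p _ => ?_
    rw [Real.rpow_neg_one, one_div]
  rw [h1, hφ, eq_div_iff (mul_ne_zero hq0.ne' hprod)]
  field_simp

/-- The factors of `E_{1/2}` are bounded: `(1 - p^{-1/2})⁻¹ ≤ 4` (`p ≥ 2`). [folklore] -/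
theorem eulerFactor_half_le_four {p : ℕ} (hp : p.Prime) : (1 - (p : ℝ) ^ (-(1 / 2 : ℝ)))⁻¹ ≤ 4 := by
  have hp2 : (2 : ℝ) ≤ p := by exact_mod_cast hp.two_le
  -- `p^{-1/2} ≤ 2^{-1/2} ≤ 3/4`
  have h1 : (p : ℝ) ^ (-(1 / 2 : ℝ)) ≤ (2 : ℝ) ^ (-(1 / 2 : ℝ)) :=
    Real.rpow_le_rpow_of_nonpos (by norm_num) hp2 (by norm_num)
  have h2 : (2 : ℝ) ^ (-(1 / 2 : ℝ)) ≤ 3 / 4 := by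
    rw [Real.rpow_neg (by norm_num), ← Real.sqrt_eq_rpow]
    have hs : Real.sqrt 2 * Real.sqrt 2 = 2 := Real.mul_self_sqrt (by norm_num)
    have hs0 : 0 < Real.sqrt 2 := Real.sqrt_pos.2 (by norm_num)
    rw [inv_le_comm₀ hs0 (by norm_num)]
    nlinarith
  obtain ⟨h0, _⟩ := prime_rpow_neg_lt_one hp (by norm_num : (0 : ℝ) < 1 / 2)
  rw [inv_le_comm₀ (by linarith) (by norm_num)]
  linarith

/-! ### Sums over `P`-factored ("smooth") numbers: Euler products -/

/-- `n ↦ n^{-σ}` as a monoid homomorphism `ℕ →* ℝ` (completely multiplicative). [folklore] -/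
def rpowHom (σ : ℝ) : ℕ →* ℝ where
  toFun n := (n : ℝ) ^ (-σ)
  map_one' := by simp
  map_mul' m n := by
    push_cast
    exact Real.mul_rpow (Nat.cast_nonneg m) (Nat.cast_nonneg n)

/-- Unfolding `rpowHom`. [folklore] -/
@[simp] theorem rpowHom_apply (σ : ℝ) (n : ℕ) : rpowHom σ n = (n : ℝ) ^ (-σ) := rfl

/-- **`∑_{p ∣ k ⇒ p ∈ P} k^{-σ} = ∏_{p ∈ P} (1 - p^{-σ})⁻¹`** (`σ > 0`, `P` a finite set of primes):
the series over the `P`-factored numbers converges absolutely with this sum.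
[folklore] -/
theorem hasSum_rpow_factoredNumbers {σ : ℝ} (hσ : 0 < σ) {P : Finset ℕ} (hP : ∀ p ∈ P, p.Prime) :
    Summable (fun m : Nat.factoredNumbers P => ‖(m : ℝ) ^ (-σ)‖) ∧
      HasSum (fun m : Nat.factoredNumbers P => ((m : ℕ) : ℝ) ^ (-σ)) (eulerFactorProd σ P) := by
  have h := EulerProduct.summable_and_hasSum_factoredNumbers_prod_filter_prime_geometric
    (f := rpowHom σ) (fun {p} hp => ?_) P
  · have hfilter : P.filter Nat.Prime = P := filter_true_of_mem hP
    simp only [rpowHom_apply, hfilter] at h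
    exact h
  · rw [rpowHom_apply, Real.norm_eq_abs, abs_of_pos (prime_rpow_neg_lt_one hp hσ).1]
    exact (prime_rpow_neg_lt_one hp hσ).2

/-- The finite smooth sums `∑_{k ≤ N, p ∣ k ⇒ p ∈ P} k^{-σ}`. [folklore] -/
def smoothSum (σ : ℝ) (P : Finset ℕ) (N : ℕ) : ℝ :=
  ∑ k ∈ (Finset.Icc 1 N).filter (fun k => k.primeFactors ⊆ P), (k : ℝ) ^ (-σ)

/-- Unfolding `smoothSum`. [folklore] -/
theorem smoothSum_def (σ : ℝ) (P : Finset ℕ) (N : ℕ) :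
    smoothSum σ P N = ∑ k ∈ (Finset.Icc 1 N).filter (fun k => k.primeFactors ⊆ P), (k : ℝ) ^ (-σ) := rfl

/-- `smoothSum ≥ 0`. [folklore] -/
theorem smoothSum_nonneg (σ : ℝ) (P : Finset ℕ) (N : ℕ) : 0 ≤ smoothSum σ P N :=
  sum_nonneg fun k _ => Real.rpow_nonneg (Nat.cast_nonneg k) _

/-- `smoothSum` is monotone in `N`. [folklore] -/
theorem smoothSum_mono (σ : ℝ) (P : Finset ℕ) {N N' : ℕ} (h : N ≤ N') :
    smoothSum σ P N ≤ smoothSum σ P N' := by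
  unfold smoothSum
  refine sum_le_sum_of_subset_of_nonneg (fun k hk => ?_) fun k _ _ => Real.rpow_nonneg (Nat.cast_nonneg k) _
  simp only [mem_filter, Finset.mem_Icc] at hk ⊢
  exact ⟨⟨hk.1.1, hk.1.2.trans h⟩, hk.2⟩

/-- The finite smooth sum as a sum over a finset of the subtype of `P`-factored numbers.
[folklore] -/
theorem smoothSum_eq_sum_subtype (σ : ℝ) (P : Finset ℕ) (N : ℕ) :
    smoothSum σ P N = ∑ m ∈ (Finset.Icc 1 N).subtype (· ∈ Nat.factoredNumbers P),
      (((m : ℕ) : ℝ)) ^ (-σ) := by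
  rw [smoothSum]
  have hset : (Finset.Icc 1 N).filter (fun k => k.primeFactors ⊆ P) =
      (Finset.Icc 1 N).filter (· ∈ Nat.factoredNumbers P) := by
    refine Finset.filter_congr fun k hk => ?_
    rw [Nat.mem_factoredNumbers_iff_primeFactors_subset]
    have : k ≠ 0 := by have := (Finset.mem_Icc.1 hk).1; omega
    exact ⟨fun h => ⟨this, h⟩, fun h => h.2⟩
  rw [hset, ← Finset.subtype_map, Finset.sum_map]
  rfl

/-- **`∑_{k ≤ N, p ∣ k ⇒ p ∈ P} k^{-σ} ≤ ∏_{p ∈ P} (1 - p^{-σ})⁻¹`**. [folklore] -/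
theorem smoothSum_le_eulerFactorProd {σ : ℝ} (hσ : 0 < σ) {P : Finset ℕ} (hP : ∀ p ∈ P, p.Prime)
    (N : ℕ) : smoothSum σ P N ≤ eulerFactorProd σ P := by
  rw [smoothSum_eq_sum_subtype]
  exact sum_le_hasSum _ (fun m _ => Real.rpow_nonneg (Nat.cast_nonneg _) _)
    (hasSum_rpow_factoredNumbers hσ hP).2

/-- **The tail of the smooth harmonic sum**: for `y ≥ 1`,
`0 ≤ ∏_{p∈P}(1 - 1/p)⁻¹ - ∑_{k ≤ y, p∣k ⇒ p∈P} 1/k ≤ y^{-1/2} ∏_{p ∈ P}(1 - p^{-1/2})⁻¹`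
(Rankin: a factored `k > y` has `1/k ≤ y^{-1/2} k^{-1/2}`). [folklore] -/
theorem eulerFactorProd_sub_smoothSum_le {P : Finset ℕ} (hP : ∀ p ∈ P, p.Prime) {y : ℝ} (hy : 1 ≤ y) :
    0 ≤ eulerFactorProd 1 P - smoothSum 1 P ⌊y⌋₊ ∧
      eulerFactorProd 1 P - smoothSum 1 P ⌊y⌋₊ ≤ y ^ (-(1 / 2 : ℝ)) * eulerFactorProd (1 / 2) P := by
  classical
  refine ⟨by linarith [smoothSum_le_eulerFactorProd one_pos hP ⌊y⌋₊], ?_⟩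
  obtain ⟨hs1, hH1⟩ := hasSum_rpow_factoredNumbers one_pos hP
  obtain ⟨hsh, hHh⟩ := hasSum_rpow_factoredNumbers (by norm_num : (0 : ℝ) < 1 / 2) hP
  set S : Finset (Nat.factoredNumbers P) := (Finset.Icc 1 ⌊y⌋₊).subtype (· ∈ Nat.factoredNumbers P) with hS
  have hsum1 : Summable fun m : Nat.factoredNumbers P => ((m : ℕ) : ℝ) ^ (-(1 : ℝ)) := hH1.summable
  have hsumh : Summable fun m : Nat.factoredNumbers P => ((m : ℕ) : ℝ) ^ (-(1 / 2 : ℝ)) := hHh.summable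
  -- `E_1 = smoothSum + tail`
  have hsplit := hsum1.sum_add_tsum_subtype_compl S
  rw [hH1.tsum_eq] at hsplit
  have htail : eulerFactorProd 1 P - smoothSum 1 P ⌊y⌋₊ =
      ∑' m : {m : Nat.factoredNumbers P // m ∉ S}, (((m : Nat.factoredNumbers P) : ℕ) : ℝ) ^ (-(1 : ℝ)) := by
    rw [smoothSum_eq_sum_subtype, ← hS]
    linarith
  rw [htail]
  -- pointwise on the tail: `m > ⌊y⌋`, so `m ≥ y` and `m⁻¹ ≤ y^{-1/2} m^{-1/2}`
  have hpt : ∀ m : {m : Nat.factoredNumbers P // m ∉ S},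
      (((m : Nat.factoredNumbers P) : ℕ) : ℝ) ^ (-(1 : ℝ)) ≤
        y ^ (-(1 / 2 : ℝ)) * (((m : Nat.factoredNumbers P) : ℕ) : ℝ) ^ (-(1 / 2 : ℝ)) := by
    rintro ⟨⟨m, hm⟩, hmS⟩
    have hm0 : m ≠ 0 := Nat.ne_zero_of_mem_factoredNumbers hm
    have hmy : y ≤ m := by
      by_contra hlt
      push Not at hlt
      apply hmS
      rw [hS, mem_subtype, Finset.mem_Icc]
      exact ⟨Nat.one_le_iff_ne_zero.2 hm0, Nat.le_floor hlt.le⟩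
    have hm0' : (0 : ℝ) < m := by exact_mod_cast Nat.pos_of_ne_zero hm0
    simp only
    rw [show (-(1 : ℝ)) = -(1 / 2 : ℝ) + -(1 / 2 : ℝ) by norm_num, Real.rpow_add hm0']
    refine mul_le_mul_of_nonneg_right ?_ (Real.rpow_nonneg hm0'.le _)
    exact Real.rpow_le_rpow_of_nonpos (by linarith) hmy (by norm_num)
  have hsumt1 : Summable fun m : {m : Nat.factoredNumbers P // m ∉ S} =>
      (((m : Nat.factoredNumbers P) : ℕ) : ℝ) ^ (-(1 : ℝ)) := hsum1.subtype _
  have hsumth : Summable fun m : {m : Nat.factoredNumbers P // m ∉ S} =>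
      y ^ (-(1 / 2 : ℝ)) * (((m : Nat.factoredNumbers P) : ℕ) : ℝ) ^ (-(1 / 2 : ℝ)) :=
    (hsumh.subtype _).mul_left _
  calc ∑' m : {m : Nat.factoredNumbers P // m ∉ S}, (((m : Nat.factoredNumbers P) : ℕ) : ℝ) ^ (-(1 : ℝ))
      ≤ ∑' m : {m : Nat.factoredNumbers P // m ∉ S},
          y ^ (-(1 / 2 : ℝ)) * (((m : Nat.factoredNumbers P) : ℕ) : ℝ) ^ (-(1 / 2 : ℝ)) :=
        hsumt1.tsum_le_tsum hpt hsumth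
    _ = y ^ (-(1 / 2 : ℝ)) * ∑' m : {m : Nat.factoredNumbers P // m ∉ S},
          (((m : Nat.factoredNumbers P) : ℕ) : ℝ) ^ (-(1 / 2 : ℝ)) := tsum_mul_left
    _ ≤ y ^ (-(1 / 2 : ℝ)) * eulerFactorProd (1 / 2) P := by
        refine mul_le_mul_of_nonneg_left ?_ (Real.rpow_nonneg (by linarith) _)
        rw [← hHh.tsum_eq]
        exact Summable.tsum_subtype_le _ _ (fun m => Real.rpow_nonneg (Nat.cast_nonneg _) _) hsumh

/-! ### The `q`-smooth indicator and `μ · 1_{(·,q)=1} = 1_{q-smooth} ⋆ μ` -/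

/-- `1_{q-smooth}(n) = [n ≥ 1 ∧ every prime factor of n divides q]`, a real arithmetic function.
[folklore] -/
def smoothInd (q : ℕ) : ArithmeticFunction ℝ :=
  ⟨fun n => if n ≠ 0 ∧ n.primeFactors ⊆ q.primeFactors then 1 else 0, by simp⟩

/-- Unfolding `1_{q-smooth}`. [folklore] -/
theorem smoothInd_apply (q n : ℕ) :
    smoothInd q n = if n ≠ 0 ∧ n.primeFactors ⊆ q.primeFactors then 1 else 0 := rfl

/-- `1_{q-smooth}` is multiplicative (indeed completely). [folklore] -/
theorem isMultiplicative_smoothInd (q : ℕ) : (smoothInd q).IsMultiplicative := by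
  refine IsMultiplicative.iff_ne_zero.2 ⟨?_, ?_⟩
  · rw [smoothInd_apply, if_pos ⟨one_ne_zero, by simp⟩]
  · intro m n hm hn _
    have hmn0 : m * n ≠ 0 := Nat.mul_ne_zero hm hn
    simp only [smoothInd_apply, Nat.primeFactors_mul hm hn, Finset.union_subset_iff]
    by_cases h1 : m.primeFactors ⊆ q.primeFactors <;> by_cases h2 : n.primeFactors ⊆ q.primeFactors <;>
      simp [h1, h2, hm, hn]

/-- At a prime power `p^j`, `j ≥ 1`, `q ≠ 0`: `1_{q-smooth}(p^j) = [p ∣ q]`. [folklore] -/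
theorem smoothInd_apply_prime_pow {q : ℕ} (hq : q ≠ 0) {p : ℕ} (hp : p.Prime) {j : ℕ} (hj : j ≠ 0) :
    smoothInd q (p ^ j) = if p ∣ q then 1 else 0 := by
  rw [smoothInd_apply, Nat.primeFactors_prime_pow hj hp]
  have hpj : p ^ j ≠ 0 := pow_ne_zero _ hp.ne_zero
  have hiff : ({p} : Finset ℕ) ⊆ q.primeFactors ↔ p ∣ q := by
    rw [Finset.singleton_subset_iff, Nat.mem_primeFactors]
    exact ⟨fun h => h.2.1, fun h => ⟨hp, h, hq⟩⟩
  simp only [ne_eq, hpj, not_false_eq_true, true_and, hiff]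

/-- **`(μ · 1_{(·,q)=1}) ⋆ ζ = 1_{q-smooth}`**: `∑_{d ∣ n, (d,q)=1} μ(d) = [n is q-smooth]` (`q ≠ 0`).
Both sides are multiplicative; at `p^j` both equal `[p ∣ q]`. [folklore] -/
theorem moebius_pmul_copInd_mul_zeta {q : ℕ} (hq : q ≠ 0) :
    ((μ : ArithmeticFunction ℝ).pmul (SquarefreeSums.copInd q)) * (ζ : ArithmeticFunction ℝ) = smoothInd q := by
  set f : ArithmeticFunction ℝ := (μ : ArithmeticFunction ℝ).pmul (SquarefreeSums.copInd q) with hf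
  have hfm : f.IsMultiplicative :=
    ArithmeticFunction.isMultiplicative_moebius.intCast.pmul (SquarefreeSums.isMultiplicative_copInd q)
  have hζ : (ζ : ArithmeticFunction ℝ).IsMultiplicative := isMultiplicative_zeta.natCast
  refine (IsMultiplicative.eq_iff_eq_on_prime_powers _ (hfm.mul hζ) _ (isMultiplicative_smoothInd q)).2 ?_
  intro p j hp
  rcases Nat.eq_zero_or_pos j with rfl | hj
  · rw [pow_zero, (hfm.mul hζ).map_one, (isMultiplicative_smoothInd q).map_one]
  rw [smoothInd_apply_prime_pow hq hp hj.ne', SquarefreeSums.mul_apply_prime_pow _ _ hp]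
  -- `f(p^i) ζ(p^{j-i})`: `f(1) = 1`, `f(p) = -[p ∤ q]`, `f(p^i) = 0` for `i ≥ 2`
  have hf0 : f (p ^ 0) = 1 := by rw [pow_zero, hfm.map_one]
  have hf1 : f (p ^ 1) = if p ∣ q then 0 else -1 := by
    rw [pow_one, hf, pmul_apply, SquarefreeSums.copInd_apply, intCoe_apply,
      ArithmeticFunction.moebius_apply_prime hp]
    by_cases h : p ∣ q
    · rw [if_pos h, if_neg]; · simp
      exact fun h' => ((Nat.Prime.coprime_iff_not_dvd hp).1 h'.2) h
    · rw [if_neg h, if_pos ⟨hp.ne_zero, (Nat.Prime.coprime_iff_not_dvd hp).2 h⟩]; simp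
  have hfi : ∀ i, 2 ≤ i → f (p ^ i) = 0 := by
    intro i hi
    rw [hf, pmul_apply, intCoe_apply, ArithmeticFunction.moebius_apply_prime_pow hp (by omega)]
    simp [show i ≠ 1 by omega]
  have hζv : ∀ i, ((ζ : ArithmeticFunction ℝ)) (p ^ i) = 1 := fun i => by
    rw [natCoe_apply, zeta_apply, if_neg (pow_ne_zero _ hp.ne_zero)]; simp
  simp_rw [hζv, mul_one]
  -- split the range at `i = 0, 1`
  obtain ⟨j', rfl⟩ : ∃ j', j = j' + 1 := ⟨j - 1, by omega⟩
  rw [sum_range_succ', sum_range_succ']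
  simp only [zero_add]
  rw [hf0, hf1]
  have hrest : ∑ i ∈ range j', f (p ^ (i + 1 + 1)) = 0 :=
    sum_eq_zero fun i _ => hfi _ (by omega)
  rw [hrest, zero_add]
  split_ifs <;> norm_num

/-- **`μ · 1_{(·,q)=1} = 1_{q-smooth} ⋆ μ`** (`q ≠ 0`). [folklore] -/
theorem moebius_pmul_copInd_eq {q : ℕ} (hq : q ≠ 0) :
    (μ : ArithmeticFunction ℝ).pmul (SquarefreeSums.copInd q) = smoothInd q * (μ : ArithmeticFunction ℝ) := by
  rw [← moebius_pmul_copInd_mul_zeta hq, mul_assoc, coe_zeta_mul_coe_moebius, mul_one]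

/-! ### The coprimality-twisted Riesz mean `M₁(y; q)` -/

/-- `M₁(y; q) = ∑_{1 ≤ n ≤ y, (n,q)=1} μ(n) log(y/n)/n`. [folklore] -/
def coprimeLogSum (q : ℕ) (y : ℝ) : ℝ :=
  ∑ e ∈ (Finset.Icc 1 ⌊y⌋₊).filter (fun e => e.Coprime q), (μ e : ℝ) / e * Real.log (y / e)

/-- Unfolding `M₁(y; q)`. [folklore] -/
theorem coprimeLogSum_def (q : ℕ) (y : ℝ) : coprimeLogSum q y =
    ∑ e ∈ (Finset.Icc 1 ⌊y⌋₊).filter (fun e => e.Coprime q), (μ e : ℝ) / e * Real.log (y / e) := rfl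

/-- **Removing the coprimality condition**: for `q ≠ 0`,
`M₁(y; q) = ∑_{k ≤ y, p ∣ k ⇒ p ∣ q} M₁(y/k)/k`. [folklore] -/
theorem coprimeLogSum_eq_sum_smooth {q : ℕ} (hq : q ≠ 0) (y : ℝ) :
    coprimeLogSum q y = ∑ k ∈ (Finset.Icc 1 ⌊y⌋₊).filter (fun k => k.primeFactors ⊆ q.primeFactors),
      1 / (k : ℝ) * moebiusLogSum (y / k) := by
  classical
  set Y := ⌊y⌋₊ with hY
  set h : ℕ → ℝ := fun n => Real.log (y / n) / n with hh
  -- Step 1: the left side through the arithmetic function `f = μ · 1_{(·,q)=1}`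
  have h1 : coprimeLogSum q y = ∑ n ∈ Finset.Icc 1 Y,
      ((μ : ArithmeticFunction ℝ).pmul (SquarefreeSums.copInd q)) n * h n := by
    rw [coprimeLogSum, ← hY, sum_filter]
    refine sum_congr rfl fun n hn => ?_
    have hn0 : n ≠ 0 := by have := (Finset.mem_Icc.1 hn).1; omega
    rw [pmul_apply, intCoe_apply, SquarefreeSums.copInd_apply]
    by_cases hc : n.Coprime q
    · rw [if_pos hc, if_pos ⟨hn0, hc⟩, hh]; ring
    · rw [if_neg hc, if_neg (fun h' => hc h'.2)]; ring
  -- Step 2: `f = 1_{q-smooth} ⋆ μ`, expand the convolution and rearrange (hyperbola)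
  have h2 : ∑ n ∈ Finset.Icc 1 Y, ((μ : ArithmeticFunction ℝ).pmul (SquarefreeSums.copInd q)) n * h n =
      ∑ k ∈ Finset.Icc 1 Y, ∑ e ∈ Finset.Icc 1 (Y / k), smoothInd q k * (μ e : ℝ) * h (k * e) := by
    rw [moebius_pmul_copInd_eq hq, ← SquarefreeSums.sum_Icc_sum_divisorsAntidiagonal
      (fun k e => smoothInd q k * (μ e : ℝ) * h (k * e)) Y]
    refine sum_congr rfl fun n hn => ?_
    rw [mul_apply, sum_mul]
    refine sum_congr rfl fun x hx => ?_
    rw [(Nat.mem_divisorsAntidiagonal.1 hx).1, intCoe_apply]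
  -- Step 3: the inner sums are `M₁(y/k)/k`
  rw [h1, h2, sum_filter]
  refine sum_congr rfl fun k hk => ?_
  have hk0 : k ≠ 0 := by have := (Finset.mem_Icc.1 hk).1; omega
  have hk0' : (k : ℝ) ≠ 0 := by exact_mod_cast hk0
  rw [smoothInd_apply]
  simp only [ne_eq, hk0, not_false_eq_true, true_and]
  split_ifs with hs
  · rw [moebiusLogSum, hY, ← Nat.floor_div_natCast, mul_sum]
    refine sum_congr rfl fun e _ => ?_
    rw [hh]
    simp only [Nat.cast_mul]
    rw [div_div]
    field_simp
  · simp

/-- The smooth sum over `q.primeFactors` is the Euler product `E_1 = q/φ(q)` up to the tail.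
Specialisation of the bounds above to `P = primeFactors q`. [folklore] -/
theorem primeFactors_prime (q : ℕ) : ∀ p ∈ q.primeFactors, p.Prime :=
  fun _ hp => Nat.prime_of_mem_primeFactors hp

/-- **`|M₁(y; q)| ≤ C₀ q/φ(q)`** where `C₀ = sup_u |M₁(u)|`: precisely, for any bound
`|M₁(u)| ≤ C₀` (all `u`), `|M₁(y; q)| ≤ C₀ ∏_{p ∣ q}(1 - 1/p)⁻¹`. [folklore] -/
theorem abs_coprimeLogSum_le {C₀ : ℝ} (hC₀ : ∀ u, |moebiusLogSum u| ≤ C₀) {q : ℕ} (hq : q ≠ 0) (y : ℝ) :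
    |coprimeLogSum q y| ≤ C₀ * eulerFactorProd 1 q.primeFactors := by
  have hC0 : 0 ≤ C₀ := (abs_nonneg _).trans (hC₀ 0)
  rw [coprimeLogSum_eq_sum_smooth hq]
  calc |∑ k ∈ (Finset.Icc 1 ⌊y⌋₊).filter (fun k => k.primeFactors ⊆ q.primeFactors), 1 / (k : ℝ) * moebiusLogSum (y / k)|
      ≤ ∑ k ∈ (Finset.Icc 1 ⌊y⌋₊).filter (fun k => k.primeFactors ⊆ q.primeFactors), |1 / (k : ℝ) * moebiusLogSum (y / k)| :=
        abs_sum_le_sum_abs _ _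
    _ ≤ ∑ k ∈ (Finset.Icc 1 ⌊y⌋₊).filter (fun k => k.primeFactors ⊆ q.primeFactors), (k : ℝ) ^ (-(1 : ℝ)) * C₀ :=
        sum_le_sum fun k _ => by
          rw [abs_mul, Real.rpow_neg_one, ← one_div, abs_of_nonneg (by positivity)]
          exact mul_le_mul_of_nonneg_left (hC₀ _) (by positivity)
    _ = smoothSum 1 q.primeFactors ⌊y⌋₊ * C₀ := by rw [smoothSum, sum_mul]
    _ ≤ eulerFactorProd 1 q.primeFactors * C₀ :=
        mul_le_mul_of_nonneg_right (smoothSum_le_eulerFactorProd one_pos (primeFactors_prime q) _) hC0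
    _ = C₀ * eulerFactorProd 1 q.primeFactors := mul_comm _ _

/-- **`M₁(y; q) = q/φ(q) + o(1)`, explicitly**: given `|M₁(u)| ≤ C₀` (all `u`) and
`|M₁(u) - 1| ≤ ε` for `u ≥ √y`, one has for `y ≥ 1`, `q ≠ 0`:
`|M₁(y; q) - ∏_{p∣q}(1-1/p)⁻¹| ≤ ε ∏_{p∣q}(1-1/p)⁻¹ + (C₀ + 2) y^{-1/4} ∏_{p∣q}(1-p^{-1/2})⁻¹`
(split the smooth `k ≤ y` at `√y`; the tails are controlled by Rankin's trick). [folklore] -/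
theorem abs_coprimeLogSum_sub_le {C₀ ε : ℝ} (hC₀ : ∀ u, |moebiusLogSum u| ≤ C₀) {y : ℝ} (hy : 1 ≤ y)
    (hε : 0 ≤ ε) (hM : ∀ u, Real.sqrt y ≤ u → |moebiusLogSum u - 1| ≤ ε) {q : ℕ} (hq : q ≠ 0) :
    |coprimeLogSum q y - eulerFactorProd 1 q.primeFactors| ≤
      ε * eulerFactorProd 1 q.primeFactors +
        (C₀ + 2) * y ^ (-(1 / 4 : ℝ)) * eulerFactorProd (1 / 2) q.primeFactors := by
  classical
  have hC0 : 0 ≤ C₀ := (abs_nonneg _).trans (hC₀ 0)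
  set P := q.primeFactors with hP
  have hPp : ∀ p ∈ P, p.Prime := primeFactors_prime q
  set Y := ⌊y⌋₊ with hY
  set A : Finset ℕ := (Finset.Icc 1 Y).filter (fun k => k.primeFactors ⊆ P) with hA
  set z := Real.sqrt y with hz
  have hz1 : 1 ≤ z := by rw [hz]; exact Real.one_le_sqrt.2 hy
  have hz0 : 0 < z := by linarith
  have hzy : z ≤ y := by
    rw [hz, Real.sqrt_le_left (by linarith)]; nlinarith
  have hE1 : 0 ≤ eulerFactorProd 1 P := (eulerFactorProd_pos one_pos hPp).le
  have hEh : 0 ≤ eulerFactorProd (1 / 2) P := (eulerFactorProd_pos (by norm_num) hPp).le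
  -- decomposition: `M₁(y;q) - E_1 = ∑_{k ∈ A} (M₁(y/k) - 1)/k - (E_1 - ∑_{k∈A} 1/k)`
  have hdec : coprimeLogSum q y - eulerFactorProd 1 P =
      ∑ k ∈ A, 1 / (k : ℝ) * (moebiusLogSum (y / k) - 1) - (eulerFactorProd 1 P - smoothSum 1 P Y) := by
    have h1 : coprimeLogSum q y = ∑ k ∈ A, 1 / (k : ℝ) * moebiusLogSum (y / k) := by
      rw [coprimeLogSum_eq_sum_smooth hq, ← hY, ← hP, ← hA]
    have h2 : smoothSum 1 P Y = ∑ k ∈ A, 1 / (k : ℝ) := by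
      rw [smoothSum, ← hA]; exact sum_congr rfl fun k _ => by rw [Real.rpow_neg_one, one_div]
    have h3 : ∑ k ∈ A, 1 / (k : ℝ) * (moebiusLogSum (y / k) - 1) =
        ∑ k ∈ A, 1 / (k : ℝ) * moebiusLogSum (y / k) - ∑ k ∈ A, 1 / (k : ℝ) := by
      rw [← sum_sub_distrib]; exact sum_congr rfl fun _ _ => by ring
    rw [h1, h2, h3]; ring
  -- the first sum, split at `z = √y`
  set A₁ : Finset ℕ := A.filter (fun k : ℕ => (k : ℝ) ≤ z) with hA₁
  set A₂ : Finset ℕ := A.filter (fun k : ℕ => ¬ (k : ℝ) ≤ z) with hA₂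
  have hsumsplit : ∑ k ∈ A, 1 / (k : ℝ) * (moebiusLogSum (y / k) - 1) =
      ∑ k ∈ A₁, 1 / (k : ℝ) * (moebiusLogSum (y / k) - 1) +
        ∑ k ∈ A₂, 1 / (k : ℝ) * (moebiusLogSum (y / k) - 1) := by
    rw [hA₁, hA₂]; exact (sum_filter_add_sum_filter_not _ _ _).symm
  -- on `A₁`: `y/k ≥ √y`, so `|M₁(y/k) - 1| ≤ ε`
  have hpart1 : |∑ k ∈ A₁, 1 / (k : ℝ) * (moebiusLogSum (y / k) - 1)| ≤ ε * eulerFactorProd 1 P := by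
    calc |∑ k ∈ A₁, 1 / (k : ℝ) * (moebiusLogSum (y / k) - 1)|
        ≤ ∑ k ∈ A₁, |1 / (k : ℝ) * (moebiusLogSum (y / k) - 1)| := abs_sum_le_sum_abs _ _
      _ ≤ ∑ k ∈ A₁, (k : ℝ) ^ (-(1 : ℝ)) * ε := sum_le_sum fun k hk => by
          have hkA : k ∈ A := (mem_filter.1 hk).1
          have hk1 : (1 : ℝ) ≤ k := by exact_mod_cast (Finset.mem_Icc.1 (mem_filter.1 hkA).1).1
          have hkz : (k : ℝ) ≤ z := (mem_filter.1 hk).2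
          rw [abs_mul, Real.rpow_neg_one, ← one_div, abs_of_nonneg (by positivity)]
          refine mul_le_mul_of_nonneg_left (hM _ ?_) (by positivity)
          -- `√y ≤ y/k` since `k ≤ √y` and `√y · √y = y`
          rw [le_div_iff₀ (by linarith), hz]
          calc Real.sqrt y * k ≤ Real.sqrt y * Real.sqrt y :=
                mul_le_mul_of_nonneg_left (by rwa [hz] at hkz) (Real.sqrt_nonneg y)
            _ = y := Real.mul_self_sqrt (by linarith)
      _ = (∑ k ∈ A₁, (k : ℝ) ^ (-(1 : ℝ))) * ε := by rw [sum_mul]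
      _ ≤ smoothSum 1 P Y * ε := by
          refine mul_le_mul_of_nonneg_right ?_ hε
          rw [smoothSum, ← hA]
          exact sum_le_sum_of_subset_of_nonneg (filter_subset _ _) fun k _ _ => Real.rpow_nonneg (Nat.cast_nonneg k) _
      _ ≤ eulerFactorProd 1 P * ε :=
          mul_le_mul_of_nonneg_right (smoothSum_le_eulerFactorProd one_pos hPp _) hε
      _ = ε * eulerFactorProd 1 P := mul_comm _ _
  -- on `A₂`: `k > √y`, bounded terms, and `∑_{k ∈ A₂} 1/k ≤ E_1 - smoothSum(⌊√y⌋) ≤ y^{-1/4} E_{1/2}`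
  have htail2 : ∑ k ∈ A₂, (k : ℝ) ^ (-(1 : ℝ)) ≤ y ^ (-(1 / 4 : ℝ)) * eulerFactorProd (1 / 2) P := by
    have hdisj : Disjoint ((Finset.Icc 1 ⌊z⌋₊).filter (fun k => k.primeFactors ⊆ P)) A₂ := by
      rw [Finset.disjoint_left]
      intro k hk hk2
      have hkz : k ≤ ⌊z⌋₊ := (Finset.mem_Icc.1 (mem_filter.1 hk).1).2
      have : (k : ℝ) ≤ z := (Nat.cast_le.2 hkz).trans (Nat.floor_le hz0.le)
      exact (mem_filter.1 hk2).2 this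
    have hsub : (Finset.Icc 1 ⌊z⌋₊).filter (fun k => k.primeFactors ⊆ P) ∪ A₂ ⊆ A := by
      refine union_subset (fun k hk => ?_) (filter_subset _ _)
      simp only [mem_filter, Finset.mem_Icc, hA] at hk ⊢
      refine ⟨⟨hk.1.1, hk.1.2.trans (Nat.floor_le_floor hzy)⟩, hk.2⟩
    have hle : smoothSum 1 P ⌊z⌋₊ + ∑ k ∈ A₂, (k : ℝ) ^ (-(1 : ℝ)) ≤ eulerFactorProd 1 P := by
      rw [smoothSum, ← sum_union hdisj]
      calc ∑ k ∈ (Finset.Icc 1 ⌊z⌋₊).filter (fun k => k.primeFactors ⊆ P) ∪ A₂, (k : ℝ) ^ (-(1 : ℝ))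
          ≤ ∑ k ∈ A, (k : ℝ) ^ (-(1 : ℝ)) :=
            sum_le_sum_of_subset_of_nonneg hsub fun k _ _ => Real.rpow_nonneg (Nat.cast_nonneg k) _
        _ = smoothSum 1 P Y := by rw [smoothSum, ← hA]
        _ ≤ eulerFactorProd 1 P := smoothSum_le_eulerFactorProd one_pos hPp _
    have htz := (eulerFactorProd_sub_smoothSum_le hPp hz1).2
    have hzpow : z ^ (-(1 / 2 : ℝ)) = y ^ (-(1 / 4 : ℝ)) := by
      rw [hz, Real.sqrt_eq_rpow, ← Real.rpow_mul (by linarith)]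
      norm_num
    rw [hzpow] at htz
    linarith
  have hpart2 : |∑ k ∈ A₂, 1 / (k : ℝ) * (moebiusLogSum (y / k) - 1)| ≤
      (C₀ + 1) * (y ^ (-(1 / 4 : ℝ)) * eulerFactorProd (1 / 2) P) := by
    calc |∑ k ∈ A₂, 1 / (k : ℝ) * (moebiusLogSum (y / k) - 1)|
        ≤ ∑ k ∈ A₂, |1 / (k : ℝ) * (moebiusLogSum (y / k) - 1)| := abs_sum_le_sum_abs _ _
      _ ≤ ∑ k ∈ A₂, (k : ℝ) ^ (-(1 : ℝ)) * (C₀ + 1) := sum_le_sum fun k hk => by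
          rw [abs_mul, Real.rpow_neg_one, ← one_div, abs_of_nonneg (by positivity)]
          refine mul_le_mul_of_nonneg_left ?_ (by positivity)
          calc |moebiusLogSum (y / k) - 1| ≤ |moebiusLogSum (y / k)| + |(1 : ℝ)| := abs_sub _ _
            _ ≤ C₀ + 1 := by rw [abs_one]; exact add_le_add (hC₀ _) le_rfl
      _ = (∑ k ∈ A₂, (k : ℝ) ^ (-(1 : ℝ))) * (C₀ + 1) := by rw [sum_mul]
      _ ≤ (y ^ (-(1 / 4 : ℝ)) * eulerFactorProd (1 / 2) P) * (C₀ + 1) :=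
          mul_le_mul_of_nonneg_right htail2 (by linarith)
      _ = (C₀ + 1) * (y ^ (-(1 / 4 : ℝ)) * eulerFactorProd (1 / 2) P) := mul_comm _ _
  -- the Euler-product tail: `0 ≤ E_1 - smoothSum(Y) ≤ y^{-1/2} E_{1/2} ≤ y^{-1/4} E_{1/2}`
  have htail3 : |eulerFactorProd 1 P - smoothSum 1 P Y| ≤ y ^ (-(1 / 4 : ℝ)) * eulerFactorProd (1 / 2) P := by
    obtain ⟨h0, h1⟩ := eulerFactorProd_sub_smoothSum_le hPp hy
    rw [← hY] at h0 h1
    rw [abs_of_nonneg h0]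
    refine h1.trans (mul_le_mul_of_nonneg_right ?_ hEh)
    exact Real.rpow_le_rpow_of_exponent_le hy (by norm_num)
  have hy4 : 0 ≤ y ^ (-(1 / 4 : ℝ)) := Real.rpow_nonneg (by linarith) _
  rw [hdec, hsumsplit]
  calc |∑ k ∈ A₁, 1 / (k : ℝ) * (moebiusLogSum (y / k) - 1) + ∑ k ∈ A₂, 1 / (k : ℝ) * (moebiusLogSum (y / k) - 1) -
        (eulerFactorProd 1 P - smoothSum 1 P Y)|
      ≤ |∑ k ∈ A₁, 1 / (k : ℝ) * (moebiusLogSum (y / k) - 1)| + |∑ k ∈ A₂, 1 / (k : ℝ) * (moebiusLogSum (y / k) - 1)| +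
        |eulerFactorProd 1 P - smoothSum 1 P Y| := by
          exact (abs_sub _ _).trans (add_le_add (abs_add_le _ _) le_rfl)
    _ ≤ ε * eulerFactorProd 1 P + (C₀ + 1) * (y ^ (-(1 / 4 : ℝ)) * eulerFactorProd (1 / 2) P) +
        y ^ (-(1 / 4 : ℝ)) * eulerFactorProd (1 / 2) P := add_le_add (add_le_add hpart1 hpart2) htail3
    _ = ε * eulerFactorProd 1 P + (C₀ + 2) * y ^ (-(1 / 4 : ℝ)) * eulerFactorProd (1 / 2) P := by ring

end Literature.NumberTheory.Sieve.GreenTao2008
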